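import Mathlib
import Literature.Combinatorics.Additive.TripleProductProperty
import Summits.MatrixMultiplication.MatrixMultiplication.Theorems.SnSubsetDichotomyHyperoctahedralSubsetsPairwisePacking

/-!
# Three-pair host packing: `vol² · |C₀∩C₁|·|C₁∩C₂|·|C₂∩C₀| ≤ (|C₀||C₁||C₂|)²`

For subgroups `C₀, C₁, C₂` of a finite group and a TPP triple `X_i ⊆ C_i`, the relative pair packing
`|X_i||X_j|·|C_i ∩ C_j| ≤ |C_i||C_j|` (`PairwisePacking.card_mul_card_mul_natCard_inf_le`, p-tree) for the
three cyclic pairs multiplies to `(|X₀||X₁||X₂|)² · ∏ |C_i ∩ C_j| ≤ (|C₀||C₁||C₂|)²`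
(`vol_sq_mul_inf_le`).  For the small-`n` census the host data are evaluated on `Finset` filters, so we
bridge `Nat.card` of centraliser subgroups (and their meets) to filter cardinalities
(`natCard_centralizer_eq`, `natCard_centralizer_inf_eq`), and record that the pair datum
`|C(μ) ∩ C(ν)|` is a simultaneous-conjugation invariant (`card_filter_comm₂_conj`).
-/

namespace Summit.MatrixMultiplication.MatrixMultiplication.Theorems.HyperoctahedralThreshold.Negative

set_option linter.dupNamespace false

open Literature.Combinatorics.Additive
open Summit.MatrixMultiplication.MatrixMultiplication.Theorems.HyperoctahedralSubsets.PairwisePacking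
  (tpp_rotate inv_mul_inj_of_tpp card_mul_card_mul_natCard_inf_le)

/-- **Three-pair host packing.**  For subgroups `C₀, C₁, C₂` of a finite group and a TPP triple
`X_i ⊆ C_i`: `(|X₀||X₁||X₂|)² · (|C₀ ∩ C₁|·|C₁ ∩ C₂|·|C₂ ∩ C₀|) ≤ (|C₀||C₁||C₂|)²` (multiply the three
relative pair packings; an empty `X_i` makes the left side vanish). [cite: CohnUmans2003, Lemma 3.1] -/
theorem vol_sq_mul_inf_le {P : Type*} [Group P] [Finite P] (C : Fin 3 → Subgroup P)
    (X : Fin 3 → Finset P) (hsub : ∀ l, ∀ σ ∈ X l, σ ∈ C l)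
    (hTPP : TripleProductProperty (X 0) (X 1) (X 2)) :
    ((X 0).card * (X 1).card * (X 2).card) ^ 2 *
        (Nat.card ↥(C 0 ⊓ C 1) * Nat.card ↥(C 1 ⊓ C 2) * Nat.card ↥(C 2 ⊓ C 0)) ≤
      (Nat.card ↥(C 0) * Nat.card ↥(C 1) * Nat.card ↥(C 2)) ^ 2 := by
  rcases (X 0).eq_empty_or_nonempty with h0 | h0
  · simp [h0]
  rcases (X 1).eq_empty_or_nonempty with h1 | h1
  · simp [h1]
  rcases (X 2).eq_empty_or_nonempty with h2 | h2
  · simp [h2]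
  have p01 := card_mul_card_mul_natCard_inf_le (hsub 0) (hsub 1) (inv_mul_inj_of_tpp hTPP h2)
  have p12 := card_mul_card_mul_natCard_inf_le (hsub 1) (hsub 2)
    (inv_mul_inj_of_tpp (tpp_rotate hTPP) h0)
  have p20 := card_mul_card_mul_natCard_inf_le (hsub 2) (hsub 0)
    (inv_mul_inj_of_tpp (tpp_rotate (tpp_rotate hTPP)) h1)
  have h := Nat.mul_le_mul (Nat.mul_le_mul p01 p12) p20
  calc ((X 0).card * (X 1).card * (X 2).card) ^ 2 *
        (Nat.card ↥(C 0 ⊓ C 1) * Nat.card ↥(C 1 ⊓ C 2) * Nat.card ↥(C 2 ⊓ C 0))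
      = (X 0).card * (X 1).card * Nat.card ↥(C 0 ⊓ C 1) *
          ((X 1).card * (X 2).card * Nat.card ↥(C 1 ⊓ C 2)) *
          ((X 2).card * (X 0).card * Nat.card ↥(C 2 ⊓ C 0)) := by ring
    _ ≤ Nat.card ↥(C 0) * Nat.card ↥(C 1) * (Nat.card ↥(C 1) * Nat.card ↥(C 2)) *
          (Nat.card ↥(C 2) * Nat.card ↥(C 0)) := h
    _ = (Nat.card ↥(C 0) * Nat.card ↥(C 1) * Nat.card ↥(C 2)) ^ 2 := by ring

/-- `Nat.card` of a centraliser subgroup `C(μ)` as a filter cardinality (evaluation form). [folklore] -/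
theorem natCard_centralizer_eq {G : Type*} [Group G] [Fintype G] [DecidableEq G] (μ : G) :
    Nat.card ↥(Subgroup.centralizer ({μ} : Set G)) =
      (Finset.univ.filter (fun σ : G => σ * μ = μ * σ)).card := by
  classical
  rw [Nat.card_eq_fintype_card, ← Fintype.card_coe]
  refine Fintype.card_congr (Equiv.subtypeEquiv (Equiv.refl G) fun σ => ?_)
  simp [Subgroup.mem_centralizer_singleton_iff]

/-- `Nat.card` of the meet of two centralisers as a filter cardinality (evaluation form). [folklore] -/
theorem natCard_centralizer_inf_eq {G : Type*} [Group G] [Fintype G] [DecidableEq G] (μ ν : G) :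
    Nat.card ↥(Subgroup.centralizer ({μ} : Set G) ⊓ Subgroup.centralizer ({ν} : Set G)) =
      (Finset.univ.filter (fun σ : G => σ * μ = μ * σ ∧ σ * ν = ν * σ)).card := by
  classical
  rw [Nat.card_eq_fintype_card, ← Fintype.card_coe]
  refine Fintype.card_congr (Equiv.subtypeEquiv (Equiv.refl G) fun σ => ?_)
  simp [Subgroup.mem_inf, Subgroup.mem_centralizer_singleton_iff]

/-- The pair datum `|C(μ) ∩ C(ν)|` is invariant under simultaneous conjugation. [folklore] -/
theorem card_filter_comm₂_conj {G : Type*} [Group G] [Fintype G] [DecidableEq G] (μ ν g : G) :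
    (Finset.univ.filter (fun σ : G => σ * (g * μ * g⁻¹) = (g * μ * g⁻¹) * σ ∧
        σ * (g * ν * g⁻¹) = (g * ν * g⁻¹) * σ)).card =
      (Finset.univ.filter (fun σ : G => σ * μ = μ * σ ∧ σ * ν = ν * σ)).card := by
  have key : ∀ (τ ρ : G), (g * τ * g⁻¹) * (g * ρ * g⁻¹) = (g * ρ * g⁻¹) * (g * τ * g⁻¹) ↔
      τ * ρ = ρ * τ := by
    intro τ ρ
    constructor
    · intro h
      have h' : g⁻¹ * ((g * τ * g⁻¹) * (g * ρ * g⁻¹)) * g = g⁻¹ * ((g * ρ * g⁻¹) * (g * τ * g⁻¹)) * g := by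
        rw [h]
      simpa [mul_assoc] using h'
    · intro h
      calc g * τ * g⁻¹ * (g * ρ * g⁻¹) = g * (τ * ρ) * g⁻¹ := by group
        _ = g * (ρ * τ) * g⁻¹ := by rw [h]
        _ = g * ρ * g⁻¹ * (g * τ * g⁻¹) := by group
  refine Finset.card_bij (fun σ _ => g⁻¹ * σ * g) (fun σ hσ => ?_) (fun σ _ σ' _ h => ?_)
    (fun τ hτ => ⟨g * τ * g⁻¹, ?_, by group⟩)
  · simp only [Finset.mem_filter, Finset.mem_univ, true_and] at hσ ⊢
    have e : g * (g⁻¹ * σ * g) * g⁻¹ = σ := by group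
    constructor
    · rw [← key, e]; exact hσ.1
    · rw [← key, e]; exact hσ.2
  · simpa [mul_assoc] using congrArg (fun x => g * x * g⁻¹) h
  · simp only [Finset.mem_filter, Finset.mem_univ, true_and] at hτ ⊢
    exact ⟨(key τ μ).2 hτ.1, (key τ ν).2 hτ.2⟩

end Summit.MatrixMultiplication.MatrixMultiplication.Theorems.HyperoctahedralThreshold.Negative
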